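import Mathlib
import HarnessLib
import Summits.PneNP.PneNP.Theorems.AeaCutRectanglesTransversalEngine
import Summits.PneNP.PneNP.Theorems.AeaCutRectanglesDutyRectangles
import Summits.PneNP.PneNP.Theorems.AeaCutRectanglesClassCuts

/-!
# Crux `FoolingMeasure` (stmt-PneNP-19727) — p4 g7: the CLOSURE LATTICE of zero cuts, the avalanche criterion,
# and the star kill of the Kneser "two piercing points" template

Companion to `Cruxes/FoolingMeasure/BarrierNotesP4g7.md`.  Continues `UnitFloor.lean` (p4 g5, `LinearOrZero`) and
`WitnessRankWall.lean` (p4 g6).  Everything concerns the HYPOTHESIS of the unit engine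
`AeaCutRectanglesFixedCutFooling.foolingMeasure_of_spreadSystem` (frame `W`, units `π i`, D1 cover, D2 exactness, SPREAD),
never `FoolingMeasure` itself.  HONEST FRAMING: elementary finite combinatorics; FRONTIER restricted-model material
(AEA cut rectangles vs NON-3-COL); nothing here bears on P versus NP.

## Contents (all sorry-free)

§1 ZERO CUTS FORM A CLOSURE SYSTEM.  `ZeroCut π B :↔ splitUnits π B = ∅`.  `zeroCut_iff` (closed under the unit rule
   "a pair inside forces its partner pairs inside"), `zeroCut_univ`, `zeroCut_empty`, `zeroCut_inter` (intersection-closed —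
   so the zero cuts of ANY pair system are exactly the closed sets of a closure operator), `zeroCut_of_indep`
   (every set containing no unit pair is closed, with all its subsets).  The unit closure `ucl π S` (least zero cut ⊇ S):
   `subset_ucl`, `zeroCut_ucl`, `ucl_subset_of_zeroCut`, `ucl_mono`, `card_lt_ucl_insert`.
§2 THE AVALANCHE CRITERION (discrete intermediate-value theorem on the lattice).  `zeroCut_insert_of_undominated` /
   `card_ucl_insert_of_undominated`: a vertex with no pair-neighbour in the zero cut `M` is added at cost exactly 1 (so an
   avalanche gap must DOMINATE its complement in the pair graph);
   `exists_zeroCut_window_of_smallSteps`: if from every zero cut `M` with `|M| < a` SOME vertex `v ∉ M` has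
   `|ucl (M ∪ {v})| ≤ |M| + (b + 1 − a)`, then a zero cut with `a ≤ |B| ≤ b` exists (grow `∅` one closure at a time);
   `exists_gap_of_no_window_zeroCut`: conversely, if NO zero cut has size in `[a, b]`, there is a zero cut `M` with
   `|M| < a` ALL of whose one-point closures jump past `b` (an AVALANCHE GAP — what every spread system must contain).
§3 TYPED TARGETS for the kill side of (Q5′) in window form: `LinearOrZeroW K ε` (more than `K·n` units ⇒ a zero cut in the
   `ε`-window), `SmallStepsW K ε` (no avalanche larger than `2εn` from zero cuts below the window),
   `linearOrZeroW_of_smallStepsW` (PROVED), `noSpread_of_linearOrZeroW` (PROVED: the window form still implies the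
   engine-level kill target `NoSpread`, restated verbatim from `UnitFloor.lean`), and the weakest useful kill form
   `LinearSplitW K ε` (some window cut splits ≤ `K·n` units; `linearSplitW_of_linearOrZeroW`, `noSpread_of_linearSplitW` PROVED).
§4 THE KNESER TEMPLATE IS DEAD FOR EVERY DESIGNED SUBFAMILY (door ♣-topological of the route sketch, AEA.md Reconnaissance 6.7
   (T1)–(T4), archive NOTES §L.7, SKETCH X3 `DoubledKneserLovasz`, route header DKL-2 "its split value is spread"; the host-level
   fact "KG(2k+2,k)/Schrijver/Mycielski have α ≥ (1/2−o(1))n by EKR stars" is already in `Lines/duty-analysis-g2.md` H1–H2 — the point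
   here is the pigeonhole version that covers small designed subfamilies, typed in the engine's vocabulary).  If the unit pairs join vertices
   carrying DISJOINT labels `φ v ⊆ S` (`DisjointlyLabelled` — the pair graph sits inside the Kneser graph of the labels),
   then every element-star `{v : j ∈ φ v}` contains no unit pair, so all its subsets are zero cuts (`zeroCut_of_subset_star`);
   by double counting (`sum_card_star`, `exists_heavy_star`) some star has `≥ k·n/N` vertices when all labels have `≥ k`
   elements and `|S| = N`; hence zero cuts of EVERY size `s` with `s·N ≤ k·n` exist (`kneser_star_zeroCuts`).  In the
   template's forced regime `N = 2k + 2` (unit-disjointness, T2) this is every size up to `n/2 − n/N`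
   (`two_piercing_zeroCuts`), and `template_window_zeroCut` puts one in the `ε`-window as soon as `ε ≥ 1/N + 1/n`:
   the split value vanishes on a near-bisection for every such design, whatever `W`, D1 or D2 say — (D3) of AEA Thm 4.2
   fails for all `N ≥ 4`, (D3_ε) for all `N ≥ 1/ε + O(1)`, so X3 / DKL-2 is false for every `ε`.
-/

set_option linter.dupNamespace false

namespace Summit.PneNP.PneNP.Cruxes.FoolingMeasure.P4g7

open Finset
open Summit.PneNP.PneNP.Theorems.AeaCutRectanglesTransversalEngine
open Summit.PneNP.PneNP.Theorems.AeaCutRectanglesDutyRectangles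
open Summit.PneNP.PneNP.Theorems.AeaCutRectanglesClassCuts

/-! ## §1  Zero cuts form a closure system -/

section closure

variable {V ι : Type*} [Fintype V] [DecidableEq V] [Fintype ι]

/-- `B` is a ZERO CUT of the pair system `π`: it splits no unit. -/
def ZeroCut (π : ι → Finset (Sym2 V)) (B : Finset V) : Prop :=
  splitUnits π B = ∅

variable (π : ι → Finset (Sym2 V))

/-- **Closure rule.**  `B` is a zero cut iff, inside every unit, one pair inside `B` forces every pair inside `B`. -/
theorem zeroCut_iff {B : Finset V} :
    ZeroCut π B ↔ ∀ i, ∀ e ∈ π i, ∀ e' ∈ π i, (∀ v ∈ e, v ∈ B) → ∀ v ∈ e', v ∈ B := by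
  unfold ZeroCut
  rw [eq_empty_iff_forall_notMem]
  constructor
  · intro h i e he e' he' hin v hv
    by_contra hvB
    exact h i (mem_splitUnits.2 ⟨⟨e, he, hin⟩, ⟨e', he', v, hv, hvB⟩⟩)
  · intro h i hi
    obtain ⟨⟨e, he, hin⟩, ⟨e', he', v, hv, hvB⟩⟩ := mem_splitUnits.1 hi
    exact hvB (h i e he e' he' hin v hv)

/-- The whole vertex set is a zero cut. -/
theorem zeroCut_univ : ZeroCut π (univ : Finset V) :=
  (zeroCut_iff π).2 fun _ _ _ _ _ _ v _ => mem_univ v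

omit [Fintype V] [DecidableEq V] [Fintype ι] in
/-- Every pair has a vertex. -/
theorem exists_mem_pair (e : Sym2 V) : ∃ v, v ∈ e := by
  induction e using Sym2.ind with
  | h a b => exact ⟨a, Sym2.mem_mk_left a b⟩

/-- A set containing NO unit pair is a zero cut (every unit is entirely Alice's). -/
theorem zeroCut_of_indep {B : Finset V} (h : ∀ i, ∀ e ∈ π i, ∃ v ∈ e, v ∉ B) : ZeroCut π B := by
  refine (zeroCut_iff π).2 fun i e he e' _ hin v _ => ?_
  obtain ⟨w, hw, hwB⟩ := h i e he
  exact absurd (hin w hw) hwB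

omit [Fintype V] [DecidableEq V] [Fintype ι] in
/-- … and "contains no unit pair" is hereditary. -/
theorem indep_mono {B B' : Finset V} (hB' : B' ⊆ B) (h : ∀ i, ∀ e ∈ π i, ∃ v ∈ e, v ∉ B) :
    ∀ i, ∀ e ∈ π i, ∃ v ∈ e, v ∉ B' := fun i e he =>
  let ⟨v, hv, hvB⟩ := h i e he
  ⟨v, hv, fun hvB' => hvB (hB' hvB')⟩

/-- The empty set is a zero cut. -/
theorem zeroCut_empty : ZeroCut π (∅ : Finset V) :=
  zeroCut_of_indep π fun _ e _ =>
    let ⟨v, hv⟩ := exists_mem_pair e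
    ⟨v, hv, notMem_empty v⟩

/-- **Zero cuts are closed under intersection** — they are the closed sets of a closure system on `V`. -/
theorem zeroCut_inter {B₁ B₂ : Finset V} (h₁ : ZeroCut π B₁) (h₂ : ZeroCut π B₂) : ZeroCut π (B₁ ∩ B₂) := by
  rw [zeroCut_iff] at h₁ h₂ ⊢
  intro i e he e' he' hin v hv
  exact mem_inter.2
    ⟨h₁ i e he e' he' (fun w hw => (mem_inter.1 (hin w hw)).1) v hv,
     h₂ i e he e' he' (fun w hw => (mem_inter.1 (hin w hw)).2) v hv⟩

open Classical in
/-- The UNIT CLOSURE of `S`: the vertices lying in every zero cut containing `S` (the least zero cut above `S`). -/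
noncomputable def ucl (S : Finset V) : Finset V :=
  univ.filter fun v => ∀ B : Finset V, S ⊆ B → ZeroCut π B → v ∈ B

theorem mem_ucl {S : Finset V} {v : V} : v ∈ ucl π S ↔ ∀ B : Finset V, S ⊆ B → ZeroCut π B → v ∈ B := by
  classical
  simp [ucl]

theorem subset_ucl (S : Finset V) : S ⊆ ucl π S :=
  fun _ hv => (mem_ucl π).2 fun _ hSB _ => hSB hv

/-- The closure is below every zero cut containing `S`. -/
theorem ucl_subset_of_zeroCut {S B : Finset V} (hSB : S ⊆ B) (hB : ZeroCut π B) : ucl π S ⊆ B :=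
  fun _ hv => (mem_ucl π).1 hv B hSB hB

/-- The closure is a zero cut. -/
theorem zeroCut_ucl (S : Finset V) : ZeroCut π (ucl π S) := by
  refine (zeroCut_iff π).2 fun i e he e' he' hin v hv => (mem_ucl π).2 fun B hSB hB => ?_
  exact (zeroCut_iff π).1 hB i e he e' he' (fun w hw => (mem_ucl π).1 (hin w hw) B hSB hB) v hv

theorem ucl_mono {S T : Finset V} (hST : S ⊆ T) : ucl π S ⊆ ucl π T :=
  ucl_subset_of_zeroCut π (hST.trans (subset_ucl π T)) (zeroCut_ucl π T)

theorem ucl_eq_self_of_zeroCut {B : Finset V} (hB : ZeroCut π B) : ucl π B = B :=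
  Subset.antisymm (ucl_subset_of_zeroCut π Subset.rfl hB) (subset_ucl π B)

/-- Adding a new vertex and closing strictly increases the size. -/
theorem card_lt_ucl_insert {M : Finset V} {v : V} (hv : v ∉ M) : M.card < (ucl π (insert v M)).card :=
  calc M.card < (insert v M).card := by rw [card_insert_of_notMem hv]; exact Nat.lt_succ_self _
    _ ≤ (ucl π (insert v M)).card := card_le_card (subset_ucl π _)

/-! ## §2  The avalanche criterion -/

/-- **Undominated vertices take unit steps.**  If `M` is a zero cut and every unit pair through `v` has another vertex
outside `M` (i.e. `v` has no pair-neighbour in `M`), then `M ∪ {v}` is again a zero cut … -/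
theorem zeroCut_insert_of_undominated {M : Finset V} (hM : ZeroCut π M) {v : V}
    (hv : ∀ i, ∀ e ∈ π i, v ∈ e → ∃ w ∈ e, w ≠ v ∧ w ∉ M) : ZeroCut π (insert v M) := by
  rw [zeroCut_iff] at hM ⊢
  intro i e he e' he' hin w hw
  by_cases hve : v ∈ e
  · obtain ⟨u, hu, huv, huM⟩ := hv i e he hve
    rcases mem_insert.1 (hin u hu) with h | h
    · exact absurd h huv
    · exact absurd h huM
  · have hinM : ∀ u ∈ e, u ∈ M := fun u hu => by
      rcases mem_insert.1 (hin u hu) with h | h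
      · exact absurd (h ▸ hu) hve
      · exact h
    exact mem_insert_of_mem (hM i e he e' he' hinM w hw)

/-- … so the closure step at an undominated vertex has size exactly one (no avalanche). -/
theorem card_ucl_insert_of_undominated {M : Finset V} (hM : ZeroCut π M) {v : V} (hvM : v ∉ M)
    (hv : ∀ i, ∀ e ∈ π i, v ∈ e → ∃ w ∈ e, w ≠ v ∧ w ∉ M) :
    (ucl π (insert v M)).card = M.card + 1 := by
  rw [ucl_eq_self_of_zeroCut π (zeroCut_insert_of_undominated π hM hv), card_insert_of_notMem hvM]

/-- **Small steps give a window zero cut** (discrete intermediate value theorem on the closure lattice).  If from every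
zero cut `M` with `|M| < a` some vertex `v ∉ M` can be added with `|ucl (M ∪ {v})| ≤ |M| + (b + 1 − a)`, then some zero
cut has `a ≤ |B| ≤ b`. -/
theorem exists_zeroCut_window_of_smallSteps (a b : ℕ)
    (h : ∀ M : Finset V, ZeroCut π M → M.card < a →
      ∃ v ∉ M, (ucl π (insert v M)).card + a ≤ M.card + b + 1) :
    ∃ B : Finset V, ZeroCut π B ∧ a ≤ B.card ∧ B.card ≤ b := by
  have aux : ∀ k : ℕ, ∀ M : Finset V, Fintype.card V - M.card ≤ k → ZeroCut π M → M.card < a →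
      ∃ B : Finset V, ZeroCut π B ∧ a ≤ B.card ∧ B.card ≤ b := by
    intro k
    induction k with
    | zero =>
      intro M hk hM hMa
      obtain ⟨v, hvM, _⟩ := h M hM hMa
      have h1 := card_lt_ucl_insert π hvM
      have h2 : (ucl π (insert v M)).card ≤ Fintype.card V := card_le_univ _
      omega
    | succ k ih =>
      intro M hk hM hMa
      obtain ⟨v, hvM, hv⟩ := h M hM hMa
      have h1 := card_lt_ucl_insert π hvM
      have h2 : (ucl π (insert v M)).card ≤ Fintype.card V := card_le_univ _
      by_cases hlt : (ucl π (insert v M)).card < a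
      · exact ih _ (by omega) (zeroCut_ucl π _) hlt
      · exact ⟨ucl π (insert v M), zeroCut_ucl π _, by omega, by omega⟩
  by_cases ha : a = 0
  · exact ⟨∅, zeroCut_empty π, by omega, by simp⟩
  · exact aux _ ∅ le_rfl (zeroCut_empty π) (by rw [card_empty]; omega)

/-- **No window zero cut forces an avalanche gap.**  If no zero cut has size in `[a, b]`, there is a zero cut `M` with
`|M| < a` such that EVERY one-point extension closes up past `b`. -/
theorem exists_gap_of_no_window_zeroCut (a b : ℕ)
    (hno : ∀ B : Finset V, ZeroCut π B → a ≤ B.card → B.card ≤ b → False) :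
    ∃ M : Finset V, ZeroCut π M ∧ M.card < a ∧ ∀ v ∉ M, b < (ucl π (insert v M)).card := by
  classical
  by_cases ha : a = 0
  · exact (hno ∅ (zeroCut_empty π) (by omega) (by simp)).elim
  set 𝓜 : Finset (Finset V) := univ.filter fun M => ZeroCut π M ∧ M.card < a with h𝓜
  have hne : 𝓜.Nonempty := ⟨∅, by rw [h𝓜, mem_filter]; exact ⟨mem_univ _, zeroCut_empty π, by simp; omega⟩⟩
  obtain ⟨M, hM, hmax⟩ := exists_max_image 𝓜 Finset.card hne
  rw [h𝓜, mem_filter] at hM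
  refine ⟨M, hM.2.1, hM.2.2, fun v hv => ?_⟩
  have h1 := card_lt_ucl_insert π hv
  by_contra hle
  push Not at hle
  by_cases hlt : (ucl π (insert v M)).card < a
  · have := hmax (ucl π (insert v M)) (by rw [h𝓜, mem_filter]; exact ⟨mem_univ _, zeroCut_ucl π _, hlt⟩)
    omega
  · exact hno _ (zeroCut_ucl π _) (by omega) hle

end closure

/-! ## §3  Typed window targets for the kill side of (Q5′) -/

section targets

/-- A D1 ∧ D2 UNIT SYSTEM on `Fin n` with `m` units (verbatim `P4g4.IsUnitSystem` / `P4g5.IsUnitSystem`; crux workfiles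
are not importable modules, so the text is repeated). -/
def IsUnitSystem (n m : ℕ) (W : Finset (Sym2 (Fin n))) (π : Fin m → Finset (Sym2 (Fin n))) : Prop :=
  (∀ i, (π i).card = 2) ∧
  (∀ t : Fin m → Sym2 (Fin n), (∀ i, t i ∈ π i) →
    (∀ e ∈ tg W t, ¬ e.IsDiag) ∧ ¬ (SimpleGraph.fromEdgeSet (↑(tg W t) : Set (Sym2 (Fin n)))).Colorable 3) ∧
  (∀ i, (SimpleGraph.fromEdgeSet (↑(gammaMinus W π i) : Set (Sym2 (Fin n)))).Colorable 3)

/-- **NoSpread** (verbatim `P4g5.NoSpread`): the engine-level kill target. -/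
def NoSpread : Prop :=
  ∀ ε : ℝ, 0 < ε → ∃ C : ℕ, ∀ᶠ n in Filter.atTop, ∀ (m : ℕ) (W : Finset (Sym2 (Fin n)))
    (π : Fin m → Finset (Sym2 (Fin n))), IsUnitSystem n m W π →
      ∃ B : Finset (Fin n), (1 / 2 - ε) * (n : ℝ) ≤ B.card ∧ (B.card : ℝ) ≤ (1 / 2 + ε) * n ∧
        ((splitUnits π B).card : ℝ) < (n : ℝ) / 2 * Real.logb 2 n + (C : ℝ) * n

/-- **LinearOrZeroW K ε** — window form of `P4g5.LinearOrZero K` (which pins `|B|` to `⌊n/2⌋ … ⌈n/2⌉` and is therefore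
exposed to parity / `1/N`-deficit artefacts, cf. `two_piercing_zeroCuts`): more than `K·n` units force a zero cut with
`(1/2 − ε) n ≤ |B| ≤ (1/2 + ε) n`. -/
def LinearOrZeroW (K : ℕ) (ε : ℝ) : Prop :=
  ∀ (n m : ℕ) (W : Finset (Sym2 (Fin n))) (π : Fin m → Finset (Sym2 (Fin n))), IsUnitSystem n m W π →
    K * n < m → ∃ B : Finset (Fin n), (1 / 2 - ε) * (n : ℝ) ≤ B.card ∧ (B.card : ℝ) ≤ (1 / 2 + ε) * n ∧
      splitUnits π B = ∅

/-- **SmallStepsW K ε** — the LOCAL (no-avalanche) form: in a system with more than `K·n` units, from every zero cut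
strictly below the window some vertex can be added whose closure grows the cut by at most `2εn` vertices.  CAVEAT: this
quantifies over EVERY zero cut below the window, which is more than the walk in `exists_zeroCut_window_of_smallSteps` needs
(one cheap step along one walk from `∅`); a system may violate `SmallStepsW` at some stranded closed set and still have a
window zero cut — so this is a candidate first stub of a kill line, not a replacement for `LinearOrZeroW`. -/
def SmallStepsW (K : ℕ) (ε : ℝ) : Prop :=
  ∀ (n m : ℕ) (W : Finset (Sym2 (Fin n))) (π : Fin m → Finset (Sym2 (Fin n))), IsUnitSystem n m W π →
    K * n < m → ∀ M : Finset (Fin n), splitUnits π M = ∅ → (M.card : ℝ) < (1 / 2 - ε) * n →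
      ∃ v ∉ M, ((ucl π (insert v M)).card : ℝ) ≤ M.card + 2 * ε * n

/-- **No avalanche ⇒ window zero cut.** -/
theorem linearOrZeroW_of_smallStepsW {K : ℕ} {ε : ℝ} (hε0 : 0 ≤ ε) (hε : ε ≤ 1 / 2) (h : SmallStepsW K ε) :
    LinearOrZeroW K ε := by
  intro n m W π hsys hm
  have hn : (0 : ℝ) ≤ n := Nat.cast_nonneg n
  have hlo : (0 : ℝ) ≤ (1 / 2 - ε) * n := mul_nonneg (by linarith) hn
  have hhi : (0 : ℝ) ≤ (1 / 2 + ε) * n := mul_nonneg (by linarith) hn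
  set a : ℕ := ⌈(1 / 2 - ε) * (n : ℝ)⌉₊ with ha
  set b : ℕ := ⌊(1 / 2 + ε) * (n : ℝ)⌋₊ with hb
  obtain ⟨B, hB, haB, hBb⟩ := exists_zeroCut_window_of_smallSteps π a b (by
    intro M hM hMa
    have hMr : (M.card : ℝ) < (1 / 2 - ε) * n := (Nat.lt_ceil).1 hMa
    obtain ⟨v, hv, hstep⟩ := h n m W π hsys hm M hM hMr
    refine ⟨v, hv, ?_⟩
    have h1 : (a : ℝ) < (1 / 2 - ε) * n + 1 := Nat.ceil_lt_add_one hlo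
    have h2 : (1 / 2 + ε) * (n : ℝ) < b + 1 := Nat.lt_floor_add_one _
    have h3 : ((ucl π (insert v M)).card : ℝ) + a < M.card + b + 2 := by linarith
    have h4 : (ucl π (insert v M)).card + a < M.card + b + 2 := by exact_mod_cast h3
    omega)
  refine ⟨B, ?_, ?_, hB⟩
  · exact (Nat.le_ceil _).trans (by exact_mod_cast haB)
  · exact le_trans (by exact_mod_cast hBb) (Nat.floor_le hhi)

theorem one_lt_two_mul_eps {ε : ℝ} (hε : 0 < ε) {N n : ℕ} (hN : 1 / (2 * ε) < N) (hn : N ≤ n) :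
    1 ≤ 2 * ε * n := by
  have hNn : (N : ℝ) ≤ n := by exact_mod_cast hn
  have h2 : 1 / (2 * ε) < n := lt_of_lt_of_le hN hNn
  rw [div_lt_iff₀ (by linarith)] at h2
  linarith

/-- **The window form still kills the engine:** `(∀ ε > 0, ∃ K, LinearOrZeroW K ε) → NoSpread`. -/
theorem noSpread_of_linearOrZeroW (h : ∀ ε : ℝ, 0 < ε → ∃ K : ℕ, LinearOrZeroW K ε) : NoSpread := by
  intro ε hε
  obtain ⟨K, hK⟩ := h ε hε
  obtain ⟨N, hN⟩ := exists_nat_gt (1 / (2 * ε))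
  refine ⟨K + 1, (Filter.eventually_ge_atTop (max N 1)).mono fun n hn m W π hsys => ?_⟩
  have hn1 : 1 ≤ n := le_of_max_le_right hn
  have hεn : 1 ≤ 2 * ε * n := one_lt_two_mul_eps hε hN (le_of_max_le_left hn)
  have hn0 : (0 : ℝ) < n := by exact_mod_cast hn1
  have hlog : 0 ≤ Real.logb 2 (n : ℝ) := Real.logb_nonneg (by norm_num) (by exact_mod_cast hn1)
  have hpos : (0 : ℝ) ≤ (n : ℝ) / 2 * Real.logb 2 n := by positivity
  by_cases hm : K * n < m
  · obtain ⟨B, hB1, hB2, h0⟩ := hK n m W π hsys hm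
    refine ⟨B, hB1, hB2, ?_⟩
    rw [h0, card_empty, Nat.cast_zero]
    push_cast
    nlinarith
  · push Not at hm
    obtain ⟨B, -, hBcard⟩ := exists_subset_card_eq (s := (univ : Finset (Fin n))) (n := (n + 1) / 2)
      (by rw [card_univ, Fintype.card_fin]; omega)
    have h1 : (n : ℝ) ≤ 2 * (B.card : ℝ) + 1 := by exact_mod_cast (by omega : n ≤ 2 * B.card + 1)
    have h2 : 2 * (B.card : ℝ) ≤ n + 1 := by exact_mod_cast (by omega : 2 * B.card ≤ n + 1)
    refine ⟨B, by nlinarith, by nlinarith, ?_⟩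
    have hsplit : (splitUnits π B).card ≤ m := (card_le_univ _).trans (by rw [Fintype.card_fin])
    have hs : ((splitUnits π B).card : ℝ) ≤ K * n := by exact_mod_cast hsplit.trans hm
    push_cast
    nlinarith

/-- **LinearSplitW K ε** — the weakest kill form that still stops the engine: EVERY D1 ∧ D2 unit system has a cut in the
`ε`-window splitting at most `K·n` units (no zero cut required; `LinearOrZeroW K ε` trivially implies it, see
`linearSplitW_of_linearOrZeroW`). -/
def LinearSplitW (K : ℕ) (ε : ℝ) : Prop :=
  ∀ (n m : ℕ) (W : Finset (Sym2 (Fin n))) (π : Fin m → Finset (Sym2 (Fin n))), IsUnitSystem n m W π → 1 ≤ 2 * ε * n →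
    ∃ B : Finset (Fin n), (1 / 2 - ε) * (n : ℝ) ≤ B.card ∧ (B.card : ℝ) ≤ (1 / 2 + ε) * n ∧
      (splitUnits π B).card ≤ K * n

theorem linearSplitW_of_linearOrZeroW {K : ℕ} {ε : ℝ} (h : LinearOrZeroW K ε) : LinearSplitW K ε := by
  intro n m W π hsys hεn
  by_cases hm : K * n < m
  · obtain ⟨B, hB1, hB2, h0⟩ := h n m W π hsys hm
    exact ⟨B, hB1, hB2, by rw [h0, card_empty]; exact Nat.zero_le _⟩
  · push Not at hm
    obtain ⟨B, -, hBcard⟩ := exists_subset_card_eq (s := (univ : Finset (Fin n))) (n := (n + 1) / 2)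
      (by rw [card_univ, Fintype.card_fin]; omega)
    have h1 : (n : ℝ) ≤ 2 * (B.card : ℝ) + 1 := by exact_mod_cast (by omega : n ≤ 2 * B.card + 1)
    have h2 : 2 * (B.card : ℝ) ≤ n + 1 := by exact_mod_cast (by omega : 2 * B.card ≤ n + 1)
    have hn : (0 : ℝ) ≤ n := Nat.cast_nonneg n
    refine ⟨B, by nlinarith, by nlinarith, ?_⟩
    exact ((card_le_univ _).trans (by rw [Fintype.card_fin])).trans hm

/-- **Linear splits already kill the engine:** `(∀ ε > 0, ∃ K, LinearSplitW K ε) → NoSpread`. -/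
theorem noSpread_of_linearSplitW (h : ∀ ε : ℝ, 0 < ε → ∃ K : ℕ, LinearSplitW K ε) : NoSpread := by
  intro ε hε
  obtain ⟨K, hK⟩ := h ε hε
  obtain ⟨N, hN⟩ := exists_nat_gt (1 / (2 * ε))
  refine ⟨K + 1, (Filter.eventually_ge_atTop (max N 1)).mono fun n hn m W π hsys => ?_⟩
  have hn1 : 1 ≤ n := le_of_max_le_right hn
  have hεn : 1 ≤ 2 * ε * n := one_lt_two_mul_eps hε hN (le_of_max_le_left hn)
  have hn0 : (0 : ℝ) < n := by exact_mod_cast hn1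
  have hlog : 0 ≤ Real.logb 2 (n : ℝ) := Real.logb_nonneg (by norm_num) (by exact_mod_cast hn1)
  have hpos : (0 : ℝ) ≤ (n : ℝ) / 2 * Real.logb 2 n := by positivity
  obtain ⟨B, hB1, hB2, hs⟩ := hK n m W π hsys hεn
  refine ⟨B, hB1, hB2, ?_⟩
  have hs' : ((splitUnits π B).card : ℝ) ≤ K * n := by exact_mod_cast hs
  push_cast
  nlinarith

end targets

/-! ## §4  The star kill of the Kneser "two piercing points" template -/

section kneser

variable {V ι X : Type*} [Fintype V] [DecidableEq V] [Fintype ι] [DecidableEq X]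

/-- The STAR of the ground element `j`: the vertices whose label contains `j`. -/
def star (φ : V → Finset X) (j : X) : Finset V :=
  univ.filter fun v => j ∈ φ v

omit [DecidableEq V] [Fintype ι] in
theorem mem_star {φ : V → Finset X} {j : X} {v : V} : v ∈ star φ j ↔ j ∈ φ v := by
  simp [star]

/-- The KNESER HOST CONDITION: every unit pair joins two vertices with disjoint labels (the pair graph lies inside the
Kneser graph `KG(φ)`; in the template the labels are the sets `F ∈ 𝓕 ⊆ C([N], k)` themselves). -/
def DisjointlyLabelled (φ : V → Finset X) (π : ι → Finset (Sym2 V)) : Prop :=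
  ∀ i, ∀ e ∈ π i, ∃ u ∈ e, ∃ w ∈ e, Disjoint (φ u) (φ w)

variable (π : ι → Finset (Sym2 V))

omit [Fintype ι] in
/-- **Stars are independent:** no unit pair lies inside a star (two sets containing `j` are not disjoint). -/
theorem star_indep {φ : V → Finset X} (hφ : DisjointlyLabelled φ π) (j : X) {B : Finset V}
    (hB : B ⊆ star φ j) : ∀ i, ∀ e ∈ π i, ∃ v ∈ e, v ∉ B := by
  intro i e he
  obtain ⟨u, hu, w, hw, hd⟩ := hφ i e he
  by_contra hcon
  push Not at hcon
  exact disjoint_left.1 hd (mem_star.1 (hB (hcon u hu))) (mem_star.1 (hB (hcon w hw)))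

/-- **Every subset of a star is a zero cut.** -/
theorem zeroCut_of_subset_star {φ : V → Finset X} (hφ : DisjointlyLabelled φ π) (j : X) {B : Finset V}
    (hB : B ⊆ star φ j) : ZeroCut π B :=
  zeroCut_of_indep π (star_indep π hφ j hB)

omit [DecidableEq V] [Fintype ι] in
/-- Double counting: `Σ_{j ∈ S} |star j| = Σ_v |φ v|` when all labels lie in `S`. -/
theorem sum_card_star (φ : V → Finset X) (S : Finset X) (hS : ∀ v, φ v ⊆ S) :
    ∑ j ∈ S, (star φ j).card = ∑ v, (φ v).card := by
  classical
  simp_rw [star, card_filter]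
  rw [sum_comm]
  refine sum_congr rfl fun v _ => ?_
  rw [← card_filter, filter_mem_eq_inter, inter_eq_right.2 (hS v)]

omit [DecidableEq V] [Fintype ι] in
/-- **A heavy star** (pigeonhole): if every label has at least `k` elements of the `N`-set `S`, some star has at least
`k·n/N` vertices. -/
theorem exists_heavy_star (φ : V → Finset X) (S : Finset X) (k : ℕ) (hSne : S.Nonempty) (hS : ∀ v, φ v ⊆ S)
    (hk : ∀ v, k ≤ (φ v).card) : ∃ j ∈ S, k * Fintype.card V ≤ S.card * (star φ j).card := by
  apply exists_le_of_sum_le hSne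
  calc ∑ _j ∈ S, k * Fintype.card V = S.card * (k * Fintype.card V) := by rw [sum_const, smul_eq_mul]
    _ ≤ S.card * ∑ j ∈ S, (star φ j).card := by
        apply Nat.mul_le_mul_left
        rw [sum_card_star φ S hS]
        calc k * Fintype.card V = ∑ _v : V, k := by rw [sum_const, smul_eq_mul, card_univ, mul_comm]
          _ ≤ ∑ v, (φ v).card := sum_le_sum fun v _ => hk v
    _ = ∑ j ∈ S, S.card * (star φ j).card := by rw [mul_sum]

/-- **KNESER-HOSTED PAIR SYSTEMS HAVE ZERO CUTS OF EVERY SIZE UP TO `k·n/N`** — whatever the frame, D1 or D2 say. -/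
theorem kneser_star_zeroCuts {φ : V → Finset X} {S : Finset X} {k : ℕ} (hSne : S.Nonempty) (hS : ∀ v, φ v ⊆ S)
    (hk : ∀ v, k ≤ (φ v).card) (hφ : DisjointlyLabelled φ π) {s : ℕ} (hs : s * S.card ≤ k * Fintype.card V) :
    ∃ B : Finset V, B.card = s ∧ ZeroCut π B := by
  obtain ⟨j, -, hj⟩ := exists_heavy_star φ S k hSne hS hk
  have hsj : s ≤ (star φ j).card := by
    have h := hs.trans hj
    rw [mul_comm] at h
    exact Nat.le_of_mul_le_mul_left h (card_pos.2 hSne)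
  obtain ⟨B, hB, hBcard⟩ := exists_subset_card_eq hsj
  exact ⟨B, hBcard, zeroCut_of_subset_star π hφ j hB⟩

/-- **The two-piercing-points regime** (`𝓕 ⊆ C([N], k)` with `N = 2k + 2`, forced by unit-disjointness, AEA 6.7 (T2)):
zero cuts of every size `s` with `s·(2k+2) ≤ k·n`, i.e. up to `n/2 − n/N`. -/
theorem two_piercing_zeroCuts {φ : V → Finset X} {S : Finset X} {k : ℕ} (hN : S.card = 2 * k + 2)
    (hS : ∀ v, φ v ⊆ S) (hk : ∀ v, (φ v).card = k) (hφ : DisjointlyLabelled φ π) {s : ℕ}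
    (hs : s * (2 * k + 2) ≤ k * Fintype.card V) : ∃ B : Finset V, B.card = s ∧ ZeroCut π B :=
  kneser_star_zeroCuts π (card_pos.1 (by omega)) hS (fun v => (hk v).ge) hφ (by rwa [hN])

/-- **Window version: the template's split value vanishes on a near-bisection.**  With `n` vertices, labels in
`C(S, k)`, `|S| = 2k + 2` and unit pairs disjointly labelled, there is a zero cut with `(1/2 − ε) n ≤ |B| ≤ (1/2 + ε) n`
as soon as `ε ≥ 1/(2k+2) + 1/n` — so (D3_ε) fails for every instance of the template with `N ≥ 1/ε + O(1)`. -/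
theorem template_window_zeroCut {φ : V → Finset X} {S : Finset X} {k : ℕ} (hN : S.card = 2 * k + 2)
    (hS : ∀ v, φ v ⊆ S) (hk : ∀ v, (φ v).card = k) (hφ : DisjointlyLabelled φ π) {ε : ℝ} (hε : ε ≤ 1 / 2)
    (hn : 0 < Fintype.card V)
    (hεN : 1 / (2 * (k : ℝ) + 2) + 1 / (Fintype.card V : ℝ) ≤ ε) :
    ∃ B : Finset V, (1 / 2 - ε) * (Fintype.card V : ℝ) ≤ B.card ∧
      (B.card : ℝ) ≤ (1 / 2 + ε) * Fintype.card V ∧ splitUnits π B = ∅ := by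
  set n : ℕ := Fintype.card V with hn'
  have hn0 : (0 : ℝ) < n := by exact_mod_cast hn
  have hN0 : (0 : ℝ) < 2 * (k : ℝ) + 2 := by positivity
  have hlo : (0 : ℝ) ≤ (1 / 2 - ε) * n := mul_nonneg (by linarith) hn0.le
  set s : ℕ := ⌈(1 / 2 - ε) * (n : ℝ)⌉₊ with hs'
  have hs1 : (s : ℝ) < (1 / 2 - ε) * n + 1 := Nat.ceil_lt_add_one hlo
  -- key arithmetic: (1/2 - ε) n + 1 ≤ k n / (2k+2)
  have hkey : ((1 / 2 - ε) * (n : ℝ) + 1) * (2 * k + 2) ≤ k * n := by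
    have h1 : 1 / (2 * (k : ℝ) + 2) * (2 * k + 2) = 1 := by field_simp
    have h2 : 1 / (n : ℝ) * n = 1 := by field_simp
    have h3 : ε * (2 * (k : ℝ) + 2) * n ≥ (1 / (2 * (k : ℝ) + 2) + 1 / n) * (2 * k + 2) * n :=
      mul_le_mul_of_nonneg_right (mul_le_mul_of_nonneg_right hεN hN0.le) hn0.le
    have h4 : (1 / (2 * (k : ℝ) + 2) + 1 / n) * (2 * k + 2) * n = n + (2 * k + 2) := by
      field_simp
    nlinarith
  have hsN : (s : ℝ) * (2 * k + 2) ≤ k * n := by nlinarith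
  have hsNnat : s * (2 * k + 2) ≤ k * n := by exact_mod_cast hsN
  obtain ⟨B, hBcard, hB⟩ := two_piercing_zeroCuts π hN hS hk hφ hsNnat
  refine ⟨B, ?_, ?_, hB⟩
  · rw [hBcard]; exact Nat.le_ceil _
  · rw [hBcard]
    have : (1 : ℝ) ≤ 2 * ε * n := by
      have h5 : 1 / (n : ℝ) ≤ ε := le_trans (by linarith [div_pos one_pos hN0]) hεN
      rw [div_le_iff₀ hn0] at h5
      linarith
    linarith

end kneser

end Summit.PneNP.PneNP.Cruxes.FoolingMeasure.P4g7
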